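import Summits.BirchSwinnertonDyer.BirchSwinnertonDyer.Theorems.ErratumRoadFiveKatoFframeValueAtoms
import Summits.BirchSwinnertonDyer.BirchSwinnertonDyer.Theorems.ErratumRoadFiveKatoFframeS1Lambda
import Summits.BirchSwinnertonDyer.BirchSwinnertonDyer.Theorems.ErratumRoadFiveKatoFframeSplitLogMinimumTamagawa
import Summits.BirchSwinnertonDyer.BirchSwinnertonDyer.Theorems.ErratumRoadFiveKatoFframeNonsplitLogMinimum
import Literature.NumberTheory.EllipticCurves.Kato2004.AdmissibleZetaClassLengthInequality
import Literature.NumberTheory.EllipticCurves.Kato2004.IwasawaH2FineSelmerDualCountRankFree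
import Literature.NumberTheory.EllipticCurves.BeilinsonKatoRankOneNonvanishing
import Literature.NumberTheory.EllipticCurves.NonEisensteinPrimeOfSurjective
import Literature.NumberTheory.EllipticCurves.CaiShuTian2014.HeegnerConditionProofs
import HarnessLib

/-!
# Crux `EulerHalfNotRamNoInertSetAtFive` (stmt-BirchSwinnertonDyer-19715), line `kato_Fframe` r5.5 — **the two PRINT binders of the
# atomised closure discharged BY NAME from Literature named facts; the Euler half on X11b ∩ {p ≥ 5, ρ̄ onto} ⟸ seven named facts +
# the TWO research valuation inequalities, nothing else** — ROUTE-INDEPENDENT module (no `Theses` import; the crux-named corollary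
# lives in `ErratumRoadFiveKatoFframeClosureOfPrint`)

LEAD seat `bsd-line-er5-p1` (g11), `--supports stmt-BirchSwinnertonDyer-19715`; theorems only (no definition, no named fact, no
instance, no notation, no `sorry`). Sequel of `ErratumRoadFiveKatoFframeValueAtoms` (p766845) / `…ClosureAtomic` (p766911, LEAD g10):
there the Euler half / the crux follow from five named facts {GZK, Kato 12.5 (4) realisability, F1′, H2Xʳ, GZ86 I.(7.3)}, two PRINT
binders `hNZsplit` / `hNZnonsplit` (rank-one non-vanishing at `p` of the Beilinson–Kato class at a split / non-split multiplicative
`p ≥ 5` with `ρ̄` onto) and two RESEARCH binders `hVsplit` / `hVnonsplit` (pure valuation inequalities). The print binders are now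
NAMED FACTS of `Literature/NumberTheory/EllipticCurves/BeilinsonKatoRankOneNonvanishing.lean` (p768048, this seat):
`Venerucci2016_kummerLog_bottomLayer_ne_zero_split` (Venerucci, Invent. math. 203 (2016), Thm. A/B: `3 < p` split multiplicative,
`E[p]` irreducible) and `BertoliniDarmonVenerucci2022_kummerLog_bottomLayer_ne_zero` (BDV, Adv. Math. 398 (2022), Thm. A in the
transcription Kim, Math. Ann. 387 (2023), Thm. 2.1 / Cor. 2.3: `p` odd, `p² ∤ N`).

CONTENTS. §1 the two binders of p766845/p766911 from the facts, token for token (`ρ̄` onto ⇒ `E[p]` irreducible —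
`hasIrreducibleModPGaloisRep_of_hasSurjectiveModNGaloisRep`; multiplicative ⇒ `f_p = 1` ⇒ `p² ∤ N` —
`factorization_conductorNorm_eq_one_of_hasMultiplicativeReductionAtPrime`); §2 `missingUpperBoundAt_of_printedFacts_of_inequalities`:
`Typed.MissingUpperBoundAt W p` on ALL of X11b ∩ {p ≥ 5, ρ̄ onto} from SEVEN named facts {GZK, Kato 12.5 (4), F1′, H2Xʳ, GZ86 I.(7.3),
Venerucci 2016, BDV 2022} and the two research inequalities ONLY (composition = p766911's `missingUpperBoundAt_of_atoms` body over
`ErratumRoadFiveKatoFframeValueAtoms.integral{ExcZero,Nonsplit}Value_of_atoms`, S1Λ p765646, S2″/S2ns; graded arithmetic by `omega`).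

NUMBERS: after this file the line's conditional closure has NO anonymous print binder left — the research surface is EXACTLY
`hVsplit` ∧ `hVnonsplit` (integral rank-one Perrin-Riou VALUES at split / non-split multiplicative `p`; not in print: workfile
`Cruxes/EulerHalfNotRamNoInertSetAtFive/Lines/kato_Fframe_r5_RESIDUE_g10.md`).

HONEST FRAMING: CONDITIONAL (named-fact hypotheses + two research binders); closes nothing; credits no registered stub. No summit
statement is proved; BSD is proved for no curve.

References: [Venerucci2016] Thm. A, Thm. B; [BertoliniDarmonVenerucci2022] Thm. A; [Kim2022] Thm. 2.1, Cor. 2.3; [Kato2004Asterisque]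
Thm. 12.4 (3), Thm. 12.5 (4) (pp. 221–222), (14.9.3), (14.14.2); [GrossZagier1986] Thm. I.(7.3); [Darmon2004] Thm. 3.22; [Serre1972] §4;
[Silverman1994] IV.10.2 (b).
-/

-- the summit and its single problem are both named `BirchSwinnertonDyer` (registry layout D-0017)
set_option linter.dupNamespace false
set_option autoImplicit false

noncomputable section

open scoped Classical
open Field WeierstrassCurve
open Literature.NumberTheory.GaloisRepresentations
open Literature.NumberTheory.EllipticCurves Literature.NumberTheory.EllipticCurves.Kato2004
open Literature.NumberTheory.EllipticCurves.Kato2004.EulerSystemValues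
open Literature.NumberTheory.EllipticCurves.Rank1Residual
open Literature.NumberTheory.EllipticCurves.Rank1Residual.Typed
open Summit.BirchSwinnertonDyer.Rank1Residual

namespace Summit.BirchSwinnertonDyer.BirchSwinnertonDyer.Theorems.ErratumRoadFiveKatoFframeNonvanishingOfPrint

/-! ## §1 The two print binders of p766845 / p766911 from the named facts -/

/-- **`hNZsplit` from Venerucci 2016** (token for token the binder of `ErratumRoadFiveKatoFframeValueAtoms.integralExcZeroValue_of_atoms`):
at `p ≥ 5` with `ρ̄_{W,p}` onto — hence `W[p]` irreducible (`hasIrreducibleModPGaloisRep_of_hasSurjectiveModNGaloisRep`, Serre) —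
analytic rank one and `p` split multiplicative, every Kummer logarithm of the bottom layer of an admissible class is `≠ 0`.
[cite: Venerucci2016, Thm. A and Thm. B (pp. 3–4)] [cite: Serre1972, §4] -/
theorem kummerLog_ne_zero_split_of_venerucci (hV : Venerucci2016_kummerLog_bottomLayer_ne_zero_split) :
    ∀ (W : WeierstrassCurve ℚ) [W.IsElliptic] [W.IsGloballyMinimal] (p : ℕ) [Fact p.Prime]
      [ContinuousSMul ℤ_[p] (W.tateModule p)],
      5 ≤ p → Surj W p → W.analyticRank = 1 → W.HasSplitMultiplicativeReductionAtPrime p →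
      ∀ (K : ZpExtension ℚ p) (hK : K.IsCyclotomic) (γ : absoluteGaloisGroup ℚ)
        (I : IwasawaH1Data W p K γ) (z₀ : I.H), K.IsTopGenerator γ → IsAdmissibleZetaClass W p K hK I z₀ →
      ∀ t : ℚ_[p], HasLocPKummerLog W p (layerZeroToTop W p K (I.proj 0 z₀)) t → t ≠ 0 := by
  intro W _ _ p _ _ h5 hsurj hr hsplit K hK γ I z₀ hγ hz t ht
  haveI : NeZero (p : ℚ) := ⟨Nat.cast_ne_zero.mpr (Fact.out : p.Prime).ne_zero⟩
  exact hV W p (by omega) hsplit (hasIrreducibleModPGaloisRep_of_hasSurjectiveModNGaloisRep W p hsurj) hr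
    K hK γ I z₀ hγ hz t ht

/-- **The non-vanishing at ANY multiplicative `p ≠ 2` from BDV 2022**: multiplicative reduction gives conductor exponent
`f_p = 1` (`factorization_conductorNorm_eq_one_of_hasMultiplicativeReductionAtPrime`, Silverman ATAEC IV.10.2 (b)), so `p² ∤ N_W`
and the fact applies: in analytic rank one every Kummer logarithm of the bottom layer of an admissible class is `≠ 0`.
[cite: BertoliniDarmonVenerucci2022, Thm. A] [cite: Kim2022, Cor. 2.3] [cite: Silverman1994, IV.10.2 (b)] -/
theorem kummerLog_ne_zero_mult_of_bdv (hB : BertoliniDarmonVenerucci2022_kummerLog_bottomLayer_ne_zero)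
    (W : WeierstrassCurve ℚ) [W.IsElliptic] [W.IsGloballyMinimal] (p : ℕ) [Fact p.Prime]
    [ContinuousSMul ℤ_[p] (W.tateModule p)] (hp : p ≠ 2) (hmult : W.HasMultiplicativeReductionAtPrime p)
    (hr : W.analyticRank = 1) (K : ZpExtension ℚ p) (hK : K.IsCyclotomic) (γ : absoluteGaloisGroup ℚ)
    (I : IwasawaH1Data W p K γ) (z₀ : I.H) (hγ : K.IsTopGenerator γ) (hz : IsAdmissibleZetaClass W p K hK I z₀)
    (t : ℚ_[p]) (ht : HasLocPKummerLog W p (layerZeroToTop W p K (I.proj 0 z₀)) t) : t ≠ 0 := by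
  refine hB W p hp ?_ hr K hK γ I z₀ hγ hz t ht
  -- `p² ∤ N_W`: `f_p = 1` at a multiplicative prime
  have hpP : p.Prime := Fact.out
  have hN : W.conductorNorm ℤ ≠ 0 := (W.conductorNorm_pos_holds).ne'
  rw [hpP.pow_dvd_iff_le_factorization hN, W.factorization_conductorNorm_eq_one_of_hasMultiplicativeReductionAtPrime p hmult]
  omega

/-- **`hNZnonsplit` from BDV 2022** (token for token the binder of `ErratumRoadFiveKatoFframeValueAtoms.integralNonsplitValue_of_atoms`;
its surjectivity and non-split hypotheses are idle — the fact needs only `p` odd and `p² ∤ N`).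
[cite: BertoliniDarmonVenerucci2022, Thm. A] [cite: Kim2022, Cor. 2.3] -/
theorem kummerLog_ne_zero_nonsplit_of_bdv (hB : BertoliniDarmonVenerucci2022_kummerLog_bottomLayer_ne_zero) :
    ∀ (W : WeierstrassCurve ℚ) [W.IsElliptic] [W.IsGloballyMinimal] (p : ℕ) [Fact p.Prime]
      [ContinuousSMul ℤ_[p] (W.tateModule p)],
      5 ≤ p → Surj W p → W.analyticRank = 1 → W.HasMultiplicativeReductionAtPrime p →
      ¬ W.HasSplitMultiplicativeReductionAtPrime p →
      ∀ (K : ZpExtension ℚ p) (hK : K.IsCyclotomic) (γ : absoluteGaloisGroup ℚ)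
        (I : IwasawaH1Data W p K γ) (z₀ : I.H), K.IsTopGenerator γ → IsAdmissibleZetaClass W p K hK I z₀ →
      ∀ t : ℚ_[p], HasLocPKummerLog W p (layerZeroToTop W p K (I.proj 0 z₀)) t → t ≠ 0 :=
  fun W _ _ p _ _ h5 _ hr hmult _ K hK γ I z₀ hγ hz t ht =>
    kummerLog_ne_zero_mult_of_bdv hB W p (by omega) hmult hr K hK γ I z₀ hγ hz t ht

/-- **`hNZsplit` from BDV 2022** (alternative to Venerucci 2016 at `p ≥ 5`: multiplicative ⇒ `p² ∤ N`).
[cite: BertoliniDarmonVenerucci2022, Thm. A] [cite: Kim2022, Cor. 2.3] -/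
theorem kummerLog_ne_zero_split_of_bdv (hB : BertoliniDarmonVenerucci2022_kummerLog_bottomLayer_ne_zero) :
    ∀ (W : WeierstrassCurve ℚ) [W.IsElliptic] [W.IsGloballyMinimal] (p : ℕ) [Fact p.Prime]
      [ContinuousSMul ℤ_[p] (W.tateModule p)],
      5 ≤ p → Surj W p → W.analyticRank = 1 → W.HasSplitMultiplicativeReductionAtPrime p →
      ∀ (K : ZpExtension ℚ p) (hK : K.IsCyclotomic) (γ : absoluteGaloisGroup ℚ)
        (I : IwasawaH1Data W p K γ) (z₀ : I.H), K.IsTopGenerator γ → IsAdmissibleZetaClass W p K hK I z₀ →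
      ∀ t : ℚ_[p], HasLocPKummerLog W p (layerZeroToTop W p K (I.proj 0 z₀)) t → t ≠ 0 :=
  fun W _ _ p _ _ h5 _ hr hsplit K hK γ I z₀ hγ hz t ht =>
    kummerLog_ne_zero_mult_of_bdv hB W p (by omega) hsplit.hasMultiplicativeReductionAtPrime hr K hK γ I z₀ hγ hz t ht

/-! ## §2 The Euler half on X11b ∩ {p ≥ 5, ρ̄ onto} from named facts + the two research inequalities -/

/-- **`Typed.MissingUpperBoundAt W p` on ALL of X11b ∩ {p ≥ 5, ρ̄ onto} from SEVEN named facts {GZK (`hGZK`), Kato 12.5 (4)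
realisability (`hReal`), Kato's length inequality F1′ (`hF1`), the rank-free 𝐇² count H2Xʳ (`hH2X`), Gross–Zagier I.(7.3) (`hGZ`),
Venerucci 2016 (`hV`), BDV 2022 (`hB`)} and the two RESEARCH valuation inequalities `hVsplit` / `hVnonsplit`** (integral rank-one
Perrin-Riou values) — NO anonymous print binder. Composition = p766911's `missingUpperBoundAt_of_atoms` body (S3/S3ns from their atoms
via `ErratumRoadFiveKatoFframeValueAtoms`, the non-vanishings now §1's theorems; S1Λ p765646; S2″/S2ns width files; graded arithmetic
by `omega`), re-run here so that this module stays route-independent. (BDV 2022 alone would serve the split sign too: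
`kummerLog_ne_zero_split_of_bdv`.) CONDITIONAL; closes nothing.
[cite: Kato2004Asterisque, Thm. 12.4 (3), Thm. 12.5 (4) (pp. 221–222), (14.9.3), (14.14.2)] [cite: Venerucci2016, Thm. A and Thm. B]
[cite: BertoliniDarmonVenerucci2022, Thm. A] [cite: GrossZagier1986, Thm. I.(7.3)] [cite: Darmon2004, Thm. 3.22] -/
theorem missingUpperBoundAt_of_printedFacts_of_inequalities
    (hGZK : rank_eq_analyticRank_of_analyticRank_le_one)
    (hReal : exists_isAdmissibleZetaClass_of_imageContainsSL2)
    (hF1 : lengthAt_fineSelmerDual_le_of_isAdmissibleZetaClass)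
    (hH2X : exists_iwasawaH2Data_fineSelmerDual_embedding_countRankFree)
    (hGZ : GrossZagier1986_thm_I_7_3)
    (hV : Venerucci2016_kummerLog_bottomLayer_ne_zero_split)
    (hB : BertoliniDarmonVenerucci2022_kummerLog_bottomLayer_ne_zero)
    (hVsplit : ∀ (W : WeierstrassCurve ℚ) [W.IsElliptic] [W.IsGloballyMinimal] (p : ℕ) [Fact p.Prime]
      [ContinuousSMul ℤ_[p] (W.tateModule p)],
      ClassX11b W p → 5 ≤ p → Surj W p → W.HasSplitMultiplicativeReductionAtPrime p →
      ∀ (h1 : W.mordellWeilRank = 1) (P : Fin W.mordellWeilRank → W.toAffine.Point),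
        W.IsMordellWeilBasis P →
      ∀ (K : ZpExtension ℚ p) (hK : K.IsCyclotomic) (γ : absoluteGaloisGroup ℚ)
        (I : IwasawaH1Data W p K γ) (z₀ : I.H), K.IsTopGenerator γ → IsAdmissibleZetaClass W p K hK I z₀ →
      ∀ t : ℚ_[p], HasLocPKummerLog W p (layerZeroToTop W p K (I.proj 0 z₀)) t → t ≠ 0 →
      ∀ q : ℚ, shaAn W = (q : ℂ) →
        t.valuation -
            2 * (padicLogLocal W p (WeierstrassCurve.Affine.Point.map (Algebra.ofId ℚ ℚ_[p]) (P (Fin.cast h1.symm 0)))).valuation ≤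
          padicValRat p q + padicValNat p W.tamagawaProduct - 2 * padicValNat p W.torsionOrder - 1)
    (hVnonsplit : ∀ (W : WeierstrassCurve ℚ) [W.IsElliptic] [W.IsGloballyMinimal] (p : ℕ) [Fact p.Prime]
      [ContinuousSMul ℤ_[p] (W.tateModule p)],
      ClassX11b W p → 5 ≤ p → Surj W p → ¬ W.HasSplitMultiplicativeReductionAtPrime p →
      ∀ (h1 : W.mordellWeilRank = 1) (P : Fin W.mordellWeilRank → W.toAffine.Point),
        W.IsMordellWeilBasis P →
      ∀ (K : ZpExtension ℚ p) (hK : K.IsCyclotomic) (γ : absoluteGaloisGroup ℚ)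
        (I : IwasawaH1Data W p K γ) (z₀ : I.H), K.IsTopGenerator γ → IsAdmissibleZetaClass W p K hK I z₀ →
      ∀ t : ℚ_[p], HasLocPKummerLog W p (layerZeroToTop W p K (I.proj 0 z₀)) t → t ≠ 0 →
      ∀ q : ℚ, shaAn W = (q : ℂ) →
        t.valuation -
            2 * (padicLogLocal W p (WeierstrassCurve.Affine.Point.map (Algebra.ofId ℚ ℚ_[p]) (P (Fin.cast h1.symm 0)))).valuation ≤
          padicValRat p q + padicValNat p W.tamagawaProduct - 2 * padicValNat p W.torsionOrder - 1) :
    ∀ (W : WeierstrassCurve ℚ) [W.IsElliptic] [W.IsGloballyMinimal] (p : ℕ) [Fact p.Prime],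
      ClassX11b W p → 5 ≤ p → Surj W p → MissingUpperBoundAt W p := by
  -- the two bundled value statements from their atoms (route-independent companion file)
  have hS3 := ErratumRoadFiveKatoFframeValueAtoms.integralExcZeroValue_of_atoms hGZK hGZ
    (kummerLog_ne_zero_split_of_venerucci hV) hVsplit
  have hS3n := ErratumRoadFiveKatoFframeValueAtoms.integralNonsplitValue_of_atoms hGZK hGZ
    (kummerLog_ne_zero_nonsplit_of_bdv hB) hVnonsplit
  -- S1Λ (p765646) and the Tate-curve minima S2″ / S2ns (width files)
  have hS1 := ErratumRoadFiveKatoFframeS1Lambda.katoLambdaLogBoundTamagawa hGZK hF1 hH2X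
  have hS2 := ErratumRoadFiveKatoFframeSplitLogMinimumTamagawa.tateUniformisationLogMinimumTamagawa
  have hS2n := ErratumRoadFiveKatoFframeNonsplitLogMinimum.nonsplitLogMinimum
  intro W _ _ p _ hX h5 hSurj
  haveI : ContinuousSMul ℤ_[p] (W.tateModule p) := TateModule.continuousSMul_padicInt
  have hr1 : W.analyticRank = 1 := hX.1
  have hmult : W.HasMultiplicativeReductionAtPrime p := hX.2.2.1
  have hmw : W.mordellWeilRank = 1 := by
    have h := (hGZK W (le_of_eq hr1)).1
    omega
  obtain ⟨P, hP⟩ := W.exists_isMordellWeilBasis_holds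
  obtain ⟨K, hK, γ, I, z₀, hγ, hz⟩ := hReal.exists_datum_of_hasSurjectiveModNGaloisRep W p h5 hSurj
  by_cases hsplit : W.HasSplitMultiplicativeReductionAtPrime p
  · obtain ⟨q, t, hq, ht, ht0, hC⟩ := hS3 W p hX h5 hSurj hsplit hmw P hP K hK γ I z₀ hγ hz
    obtain ⟨hcp, m, Q₀, Q, hQ₀, hQ0, hQv⟩ := hS2 W p h5 hsplit
    refine ⟨q, hq, ?_⟩
    have hBd := hS1 W p h5 hSurj hr1 hmult hmw P hP K hK γ I z₀ hγ hz t ht ht0 m Q₀ hQ₀ Q hQ0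
    rw [hcp] at hBd
    have htors : (0 : ℤ) ≤ padicValNat p W.torsionOrder := by positivity
    omega
  · obtain ⟨q, t, hq, ht, ht0, hC⟩ := hS3n W p hX h5 hSurj hsplit hmw P hP K hK γ I z₀ hγ hz
    obtain ⟨hc0, Q, hQ0, hQv⟩ := hS2n W p h5 hmult hsplit
    refine ⟨q, hq, ?_⟩
    have hBd := hS1 W p h5 hSurj hr1 hmult hmw P hP K hK γ I z₀ hγ hz t ht ht0 0 0 (by simp) Q hQ0
    rw [hc0] at hBd
    have htors : (0 : ℤ) ≤ padicValNat p W.torsionOrder := by positivity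
    omega

end Summit.BirchSwinnertonDyer.BirchSwinnertonDyer.Theorems.ErratumRoadFiveKatoFframeNonvanishingOfPrint

end
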